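import Summits.Ventures.PercRepro.C041TriDomTypes
import Summits.Ventures.PercRepro.C041TriSharp

/-!
# ROW C-041 — THEOREM (TWO-EXIT NORMAL FORM) and the W-AWARE DOMINATION CRITERION: every two-exit host is
`e` bare apart excesses plus manifest cone maps, with NO `NoW` hypothesis (p6, gen 40; P6-TWOEXIT-LEAN.md §52)

Setting of `C041TriDomTypes` (the status types `Typ = Bool⁶`, the type counts `tcount`, the atoms `tatom`, the fibre
decomposition `blockMap_ex2_eq_sum_types`, the complementation `tcount_tswap`, the impossible types).  Without the
hypothesis `NoW` a colouring can leave an exit neither merged nor reached (`W`); exactly TWENTY-FIVE types occur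
(`allTypes`; the other 39 are impossible — `chkTypAll_all`, a kernel `decide` over the 64), namely the eleven of
`possTypes` and the fourteen `W`-types `WB` / `BW` (red-connected exits or not), `WX`, `XW`, `WR` / `RW` (joint or
apart) and the four `WW`.  The complementation gives five further identities `N_WBj = N_WRj`, `N_WBa = N_WRa`,
`N_BWj = N_RWj`, `N_BWa = N_RWa`, `N_WWja = N_WWaj` (`tcount_WBj`, …).  THEOREM (TWO-EXIT NORMAL FORM)
(`blockMap_ex2_eq_normal`): for EVERY finite two-exit host, with the EXCESS COUNT `e = N_RRa − N_RB − N_WRj − N_RWj`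
(`excess`, an integer),
  `Θ(w, w′) = e • Q′ + N_RRj • ℓψ(w w′) + N_RB • ℓψ(w) ℓψ(w′) + N_WRj • ℓψ(ℓψ(w) w′) + N_RWj • ℓψ(w ℓψ(w′))
             + N_BX • ℓψ(w) w′ + N_XB • w ℓψ(w′) + N_XX • w w′ + N_WRa • n(w) ℓψ(w′) + N_RWa • n(w′) ℓψ(w)
             + N_WX • n(w) w′ + N_XW • n(w′) w + (N_WWjj + N_WWja) • n(w w′) 1 + (N_WWja + N_WWaa) • n(w) n(w′) 1`
— the bare apart excess `Q′ = θ_B θ_B′ + θ_R θ_R′` (`apartExcess`, `C041TriSharp`) and THIRTEEN manifest cone maps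
(products of cone members, `ℓψ` of them, `n(·) • 1`), because the three non-manifest status pairs are
`θ_R θ_B′ + θ_B θ_R′ = ℓψ(w) ℓψ(w′) − Q′`, `n(w) θ_B′ + θ_R(θ_B w · w′) = ℓψ(ℓψ(w) w′) − Q′` and its mirror.  Hence THEOREM
(DICHOTOMY) (`blockMap_ex2_eq_dichotomy`): if `N_RRa = c + e′ + N_RB + N_WRj + N_RWj`, `N_RRj = c + s₁`, `N_BX = c + s₂`,
`N_XB = c + s₃` then `Θ = c • θ_△ + e′ • Q′ + (manifest)` — the host is `c` whole triangles, `e′` bare apart excesses and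
tree maps — and the W-AWARE DOMINATION CRITERION (`e′ = 0`): (P) and the ZONE O-CUBE at the host with ANY two cone
zones (`K4v_blockMap_ex2_of_domW`, `zoneOCube_blockMap_ex2_of_domW`), and the host is a cone host as soon as the triangle
map is a cone map / as soon as `θ_△ (V a) (V b)` lies in the cone at all pure inputs (`coneHost_ex2_of_domW`,
`coneHost_ex2_of_domW_pure`).  This removes the `NoW` hypothesis of gen 39's `blockMap_ex2_eq_dom`: the diamond
`K₄ − au`, whose exit `u` is not adjacent to the anchor, and the 321 six-vertex cores with a `W`-status are now in the
range of the criterion.  The manifest maps are cone maps (`InCone_manifest`).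
-/

namespace PercRepro

namespace ZoneZ

namespace MultiExit

open ZoneData Pendant Finset TwoExit TreeClosure RelaxedTriangle

variable {V₁ E₁ U₁ U₂ : Type} (Z₁ : ZoneData V₁ E₁ U₁ U₂) (u u' a₁ : V₁)

/-! ## The twenty-five possible types -/

/-- The twenty-five types a colouring of a two-exit host can have: the eleven of `possTypes` (no `W` exit) and the
fourteen with a `W` exit — `WB` / `BW` with red-connected exits or not, `WX`, `XW`, `WR` / `RW` joint or apart, and
the four `WW`. -/
def allTypes : Finset Typ :=
  {(true, false, true, false, true, true), (true, false, true, false, true, false), (true, false, true, true, true, false),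
    (true, true, true, false, true, false), (true, true, true, true, true, true), (false, true, true, true, false, true),
    (true, true, false, true, false, true), (false, true, true, false, false, false), (true, false, false, true, false, false),
    (false, true, false, true, true, true), (false, true, false, true, false, true),
    (false, false, true, false, false, true), (false, false, true, false, false, false),
    (true, false, false, false, false, true), (true, false, false, false, false, false),
    (false, false, true, true, false, false), (true, true, false, false, false, false),
    (false, false, false, true, true, false), (false, false, false, true, false, false),
    (false, true, false, false, true, false), (false, true, false, false, false, false),
    (false, false, false, false, true, true), (false, false, false, false, true, false),
    (false, false, false, false, false, true), (false, false, false, false, false, false)}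

/-- The Boolean check over all 64 types (kernel `decide`): every type is impossible or one of the twenty-five. -/
theorem chkTypAll_all : ∀ t : Typ, (decide (Impossible t) || decide (t ∈ allTypes)) = true := by
  decide

/-- Every type is impossible or one of the twenty-five. -/
theorem impossible_or_mem_allTypes (t : Typ) : Impossible t ∨ t ∈ allTypes := by
  have h := chkTypAll_all t
  simp only [Bool.or_eq_true, decide_eq_true_eq] at h
  exact h

variable [Fintype E₁] [DecidableEq E₁]

open Classical in
/-- The sum over all types is the sum over the twenty-five possible ones. -/
theorem sum_types_eq_allTypes (F : Typ → Vec6) :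
    ∑ t : Typ, (tcount Z₁ u u' a₁ t : ℝ) • F t = ∑ t ∈ allTypes, (tcount Z₁ u u' a₁ t : ℝ) • F t := by
  symm
  apply Finset.sum_subset (Finset.subset_univ _)
  intro t _ ht
  rcases impossible_or_mem_allTypes t with h | h
  · rw [tcount_eq_zero_of_impossible Z₁ u u' a₁ t h]
    simp
  · exact absurd h ht

/-! ## The five complementation identities of the `W`-types -/

/-- `N_WBj = N_WRj`: a `W` exit and a merged-unreached exit, red-connected, versus a `W` exit and a
separated-reached exit in one blue sub-zone. -/
theorem tcount_WBj : tcount Z₁ u u' a₁ (false, false, true, false, false, true) =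
    tcount Z₁ u u' a₁ (false, false, false, true, true, false) :=
  tcount_tswap Z₁ u u' a₁ (false, false, false, true, true, false)

/-- `N_WBa = N_WRa`. -/
theorem tcount_WBa : tcount Z₁ u u' a₁ (false, false, true, false, false, false) =
    tcount Z₁ u u' a₁ (false, false, false, true, false, false) :=
  tcount_tswap Z₁ u u' a₁ (false, false, false, true, false, false)

/-- `N_BWj = N_RWj`. -/
theorem tcount_BWj : tcount Z₁ u u' a₁ (true, false, false, false, false, true) =
    tcount Z₁ u u' a₁ (false, true, false, false, true, false) :=
  tcount_tswap Z₁ u u' a₁ (false, true, false, false, true, false)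

/-- `N_BWa = N_RWa`. -/
theorem tcount_BWa : tcount Z₁ u u' a₁ (true, false, false, false, false, false) =
    tcount Z₁ u u' a₁ (false, true, false, false, false, false) :=
  tcount_tswap Z₁ u u' a₁ (false, true, false, false, false, false)

/-- `N_WWja = N_WWaj`: two `W` exits, blue-connected but not red-connected, versus red-connected but not
blue-connected. -/
theorem tcount_WWja : tcount Z₁ u u' a₁ (false, false, false, false, true, false) =
    tcount Z₁ u u' a₁ (false, false, false, false, false, true) :=
  tcount_tswap Z₁ u u' a₁ (false, false, false, false, false, true)

/-! ## THEOREM (TWO-EXIT NORMAL FORM) -/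

/-- **The excess count** `e = N_RRa − N_RB − N_WRj − N_RWj`: the number of colourings with both exits separated,
reached and apart, minus those with one separated-reached and one merged-unreached exit, minus those with one
separated-reached exit and one `W` exit in the same blue sub-zone. -/
noncomputable def excess : ℝ :=
  (tcount Z₁ u u' a₁ (false, true, false, true, false, true) : ℝ)
    - tcount Z₁ u u' a₁ (false, true, true, false, false, false)
    - tcount Z₁ u u' a₁ (false, false, false, true, true, false)
    - tcount Z₁ u u' a₁ (false, true, false, false, true, false)

/-- **THEOREM (TWO-EXIT NORMAL FORM)**: the block map of ANY two-exit host is `e` bare apart excesses plus thirteen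
manifest cone maps with the type counts as coefficients. -/
theorem blockMap_ex2_eq_normal (w w' : Vec6) :
    blockMap Z₁ (ex2 u u') a₁ (fun b => if b then w' else w) =
      excess Z₁ u u' a₁ • apartExcess w w'
        + (tcount Z₁ u u' a₁ (false, true, false, true, true, true) : ℝ) • ellv (w * w')
        + (tcount Z₁ u u' a₁ (false, true, true, false, false, false) : ℝ) • (ellv w * ellv w')
        + (tcount Z₁ u u' a₁ (false, false, false, true, true, false) : ℝ) • ellv (ellv w * w')
        + (tcount Z₁ u u' a₁ (false, true, false, false, true, false) : ℝ) • ellv (w * ellv w')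
        + (tcount Z₁ u u' a₁ (true, false, true, true, true, false) : ℝ) • (ellv w * w')
        + (tcount Z₁ u u' a₁ (true, true, true, false, true, false) : ℝ) • (w * ellv w')
        + (tcount Z₁ u u' a₁ (true, true, true, true, true, true) : ℝ) • (w * w')
        + (tcount Z₁ u u' a₁ (false, false, false, true, false, false) : ℝ) • (nAdm w • ellv w')
        + (tcount Z₁ u u' a₁ (false, true, false, false, false, false) : ℝ) • (nAdm w' • ellv w)
        + (tcount Z₁ u u' a₁ (false, false, true, true, false, false) : ℝ) • (nAdm w • w')
        + (tcount Z₁ u u' a₁ (true, true, false, false, false, false) : ℝ) • (nAdm w' • w)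
        + ((tcount Z₁ u u' a₁ (false, false, false, false, true, true) : ℝ)
            + tcount Z₁ u u' a₁ (false, false, false, false, true, false)) • (nAdm (w * w') • (1 : Vec6))
        + ((tcount Z₁ u u' a₁ (false, false, false, false, true, false) : ℝ)
            + tcount Z₁ u u' a₁ (false, false, false, false, false, false)) • ((nAdm w * nAdm w') • (1 : Vec6)) := by
  rw [blockMap_ex2_eq_sum_types, sum_types_eq_allTypes Z₁ u u' a₁]
  simp only [allTypes]
  rw [Finset.sum_insert (by decide), Finset.sum_insert (by decide), Finset.sum_insert (by decide),
    Finset.sum_insert (by decide), Finset.sum_insert (by decide), Finset.sum_insert (by decide),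
    Finset.sum_insert (by decide), Finset.sum_insert (by decide), Finset.sum_insert (by decide),
    Finset.sum_insert (by decide), Finset.sum_insert (by decide), Finset.sum_insert (by decide),
    Finset.sum_insert (by decide), Finset.sum_insert (by decide), Finset.sum_insert (by decide),
    Finset.sum_insert (by decide), Finset.sum_insert (by decide), Finset.sum_insert (by decide),
    Finset.sum_insert (by decide), Finset.sum_insert (by decide), Finset.sum_insert (by decide),
    Finset.sum_insert (by decide), Finset.sum_insert (by decide), Finset.sum_insert (by decide),
    Finset.sum_singleton]
  rw [tcount_BB_true, tcount_BB_false, tcount_RX, tcount_XR, tcount_BR, tcount_WBj, tcount_WBa, tcount_BWj,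
    tcount_BWa, tcount_WWja]
  simp only [tatom, contrib, exitOf, if_true, if_false, Bool.false_eq_true, excess]
  ext i
  simp only [Pi.add_apply, Pi.mul_apply, Pi.smul_apply, Pi.one_apply, smul_eq_mul, apartExcess, thB, thR, ellv, ell,
    nAdm, kInv]
  fin_cases i <;> simp <;> ring

/-! ## The manifest maps are cone maps -/

/-- `(a • 1) * (b • 1) = (a * b) • 1` on six-vectors. -/
theorem smul_one_mul_smul_one (a b : ℝ) : (a • (1 : Vec6)) * (b • (1 : Vec6)) = (a * b) • (1 : Vec6) := by
  ext i
  simp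

/-- `n(w) • x = (n(w) • 1) * x`. -/
theorem nAdm_smul_eq (w x : Vec6) : nAdm w • x = (nAdm w • (1 : Vec6)) * x := by
  ext i
  simp

/-- **The thirteen manifest maps of the normal form are cone maps** (for cone inputs `w`, `w′`). -/
theorem InCone_manifest {w w' : Vec6} (hw : InCone w) (hw' : InCone w') :
    InCone (ellv (w * w')) ∧ InCone (ellv w * ellv w') ∧ InCone (ellv (ellv w * w')) ∧ InCone (ellv (w * ellv w'))
      ∧ InCone (ellv w * w') ∧ InCone (w * ellv w') ∧ InCone (w * w') ∧ InCone (nAdm w • ellv w')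
      ∧ InCone (nAdm w' • ellv w) ∧ InCone (nAdm w • w') ∧ InCone (nAdm w' • w)
      ∧ InCone (nAdm (w * w') • (1 : Vec6)) ∧ InCone ((nAdm w * nAdm w') • (1 : Vec6)) := by
  have h1 := inCone_ellv hw
  have h1' := inCone_ellv hw'
  refine ⟨inCone_ellv (hw.mul hw'), h1.mul h1', inCone_ellv (h1.mul hw'), inCone_ellv (hw.mul h1'), h1.mul hw',
    hw.mul h1', hw.mul hw', ?_, ?_, ?_, ?_, InCone_nAdm_smul_one (hw.mul hw'), ?_⟩
  · rw [nAdm_smul_eq]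
    exact (InCone_nAdm_smul_one hw).mul h1'
  · rw [nAdm_smul_eq]
    exact (InCone_nAdm_smul_one hw').mul h1
  · rw [nAdm_smul_eq]
    exact (InCone_nAdm_smul_one hw).mul hw'
  · rw [nAdm_smul_eq]
    exact (InCone_nAdm_smul_one hw').mul hw
  · rw [← smul_one_mul_smul_one]
    exact (InCone_nAdm_smul_one hw).mul (InCone_nAdm_smul_one hw')

/-! ## THEOREM (DICHOTOMY) and the W-aware domination criterion -/

/-- **THEOREM (DICHOTOMY)**: a two-exit host whose counts satisfy `N_RRa = c + e′ + N_RB + N_WRj + N_RWj`,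
`N_RRj = c + s₁`, `N_BX = c + s₂`, `N_XB = c + s₃` has block map `c • θ_△ + e′ • Q′ + (manifest)`: it is `c` whole
triangles, `e′` bare apart excesses and tree maps. -/
theorem blockMap_ex2_eq_dichotomy (c e' s₁ s₂ s₃ : ℕ)
    (h0 : tcount Z₁ u u' a₁ (false, true, false, true, false, true) =
      c + e' + tcount Z₁ u u' a₁ (false, true, true, false, false, false)
        + tcount Z₁ u u' a₁ (false, false, false, true, true, false)
        + tcount Z₁ u u' a₁ (false, true, false, false, true, false))
    (h1 : tcount Z₁ u u' a₁ (false, true, false, true, true, true) = c + s₁)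
    (h2 : tcount Z₁ u u' a₁ (true, false, true, true, true, false) = c + s₂)
    (h3 : tcount Z₁ u u' a₁ (true, true, true, false, true, false) = c + s₃) (w w' : Vec6) :
    blockMap Z₁ (ex2 u u') a₁ (fun b => if b then w' else w) =
      (c : ℝ) • thetaTri w w' + (e' : ℝ) • apartExcess w w'
        + (s₁ : ℝ) • ellv (w * w')
        + (tcount Z₁ u u' a₁ (false, true, true, false, false, false) : ℝ) • (ellv w * ellv w')
        + (tcount Z₁ u u' a₁ (false, false, false, true, true, false) : ℝ) • ellv (ellv w * w')
        + (tcount Z₁ u u' a₁ (false, true, false, false, true, false) : ℝ) • ellv (w * ellv w')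
        + (s₂ : ℝ) • (ellv w * w')
        + (s₃ : ℝ) • (w * ellv w')
        + (tcount Z₁ u u' a₁ (true, true, true, true, true, true) : ℝ) • (w * w')
        + (tcount Z₁ u u' a₁ (false, false, false, true, false, false) : ℝ) • (nAdm w • ellv w')
        + (tcount Z₁ u u' a₁ (false, true, false, false, false, false) : ℝ) • (nAdm w' • ellv w)
        + (tcount Z₁ u u' a₁ (false, false, true, true, false, false) : ℝ) • (nAdm w • w')
        + (tcount Z₁ u u' a₁ (true, true, false, false, false, false) : ℝ) • (nAdm w' • w)
        + ((tcount Z₁ u u' a₁ (false, false, false, false, true, true) : ℝ)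
            + tcount Z₁ u u' a₁ (false, false, false, false, true, false)) • (nAdm (w * w') • (1 : Vec6))
        + ((tcount Z₁ u u' a₁ (false, false, false, false, true, false) : ℝ)
            + tcount Z₁ u u' a₁ (false, false, false, false, false, false)) • ((nAdm w * nAdm w') • (1 : Vec6)) := by
  rw [blockMap_ex2_eq_normal, excess, h0, h1, h2, h3, thetaTri_eq_apartExcess]
  push_cast
  ext i
  simp only [Pi.add_apply, Pi.smul_apply, smul_eq_mul]
  ring

/-- **(P) AT A TRIANGLE-DOMINATED HOST WITH TWO CONE ZONES — W-AWARE**: no `NoW` hypothesis. -/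
theorem K4v_blockMap_ex2_of_domW (c s₁ s₂ s₃ : ℕ)
    (h0 : tcount Z₁ u u' a₁ (false, true, false, true, false, true) =
      c + 0 + tcount Z₁ u u' a₁ (false, true, true, false, false, false)
        + tcount Z₁ u u' a₁ (false, false, false, true, true, false)
        + tcount Z₁ u u' a₁ (false, true, false, false, true, false))
    (h1 : tcount Z₁ u u' a₁ (false, true, false, true, true, true) = c + s₁)
    (h2 : tcount Z₁ u u' a₁ (true, false, true, true, true, false) = c + s₂)
    (h3 : tcount Z₁ u u' a₁ (true, true, true, false, true, false) = c + s₃) {w w' : Vec6} (hw : InCone w)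
    (hw' : InCone w') : K4v (blockMap Z₁ (ex2 u u') a₁ (fun b => if b then w' else w)) := by
  rw [blockMap_ex2_eq_dichotomy Z₁ u u' a₁ c 0 s₁ s₂ s₃ h0 h1 h2 h3]
  obtain ⟨m1, m2, m3, m4, m5, m6, m7, m8, m9, m10, m11, m12, m13⟩ := InCone_manifest hw hw'
  simp only [Nat.cast_zero, zero_smul, add_zero]
  repeat' apply K4v_add
  all_goals first
    | exact K4v_smul (K4v_thetaTri_of_InCone hw hw') (by positivity)
    | exact K4v_smul (K4v_of_InCone m1) (by positivity)
    | exact K4v_smul (K4v_of_InCone m2) (by positivity)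
    | exact K4v_smul (K4v_of_InCone m3) (by positivity)
    | exact K4v_smul (K4v_of_InCone m4) (by positivity)
    | exact K4v_smul (K4v_of_InCone m5) (by positivity)
    | exact K4v_smul (K4v_of_InCone m6) (by positivity)
    | exact K4v_smul (K4v_of_InCone m7) (by positivity)
    | exact K4v_smul (K4v_of_InCone m8) (by positivity)
    | exact K4v_smul (K4v_of_InCone m9) (by positivity)
    | exact K4v_smul (K4v_of_InCone m10) (by positivity)
    | exact K4v_smul (K4v_of_InCone m11) (by positivity)
    | exact K4v_smul (K4v_of_InCone m12) (by positivity)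
    | exact K4v_smul (K4v_of_InCone m13) (by positivity)

/-- The ZONE O-CUBE at a W-aware triangle-dominated host with two cone zones: `2F ≤ T₁ + T₂ + 2I`. -/
theorem zoneOCube_blockMap_ex2_of_domW (c s₁ s₂ s₃ : ℕ)
    (h0 : tcount Z₁ u u' a₁ (false, true, false, true, false, true) =
      c + 0 + tcount Z₁ u u' a₁ (false, true, true, false, false, false)
        + tcount Z₁ u u' a₁ (false, false, false, true, true, false)
        + tcount Z₁ u u' a₁ (false, true, false, false, true, false))
    (h1 : tcount Z₁ u u' a₁ (false, true, false, true, true, true) = c + s₁)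
    (h2 : tcount Z₁ u u' a₁ (true, false, true, true, true, false) = c + s₂)
    (h3 : tcount Z₁ u u' a₁ (true, true, true, false, true, false) = c + s₃) {w w' : Vec6} (hw : InCone w)
    (hw' : InCone w') :
    0 ≤ (blockMap Z₁ (ex2 u u') a₁ (fun b => if b then w' else w) 1
          - blockMap Z₁ (ex2 u u') a₁ (fun b => if b then w' else w) 0)
        + (blockMap Z₁ (ex2 u u') a₁ (fun b => if b then w' else w) 2
          - blockMap Z₁ (ex2 u u') a₁ (fun b => if b then w' else w) 0)
        + 2 * (blockMap Z₁ (ex2 u u') a₁ (fun b => if b then w' else w) 4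
          + blockMap Z₁ (ex2 u u') a₁ (fun b => if b then w' else w) 5
          - blockMap Z₁ (ex2 u u') a₁ (fun b => if b then w' else w) 3)
        - 2 * blockMap Z₁ (ex2 u u') a₁ (fun b => if b then w' else w) 0 :=
  zoneOCube_nonneg_of_K4 (K4v_blockMap_ex2_of_domW Z₁ u u' a₁ c s₁ s₂ s₃ h0 h1 h2 h3 hw hw')

/-- **A W-AWARE TRIANGLE-DOMINATED HOST IS A CONE HOST AS SOON AS THE TRIANGLE MAP IS A CONE MAP.** -/
theorem coneHost_ex2_of_domW (c s₁ s₂ s₃ : ℕ)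
    (h0 : tcount Z₁ u u' a₁ (false, true, false, true, false, true) =
      c + 0 + tcount Z₁ u u' a₁ (false, true, true, false, false, false)
        + tcount Z₁ u u' a₁ (false, false, false, true, true, false)
        + tcount Z₁ u u' a₁ (false, true, false, false, true, false))
    (h1 : tcount Z₁ u u' a₁ (false, true, false, true, true, true) = c + s₁)
    (h2 : tcount Z₁ u u' a₁ (true, false, true, true, true, false) = c + s₂)
    (h3 : tcount Z₁ u u' a₁ (true, true, true, false, true, false) = c + s₃)
    (h : ∀ X Y : Vec6, InCone X → InCone Y → InCone (thetaTri X Y)) : ConeHost Z₁ (ex2 u u') a₁ := by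
  intro w hw
  rw [bool_family_eq w, blockMap_ex2_eq_dichotomy Z₁ u u' a₁ c 0 s₁ s₂ s₃ h0 h1 h2 h3]
  have hw0 := hw false
  have hw1 := hw true
  obtain ⟨m1, m2, m3, m4, m5, m6, m7, m8, m9, m10, m11, m12, m13⟩ := InCone_manifest hw0 hw1
  simp only [Nat.cast_zero, zero_smul, add_zero]
  repeat' apply InCone.add
  all_goals first
    | exact (h _ _ hw0 hw1).smul _ (by positivity)
    | exact m1.smul _ (by positivity)
    | exact m2.smul _ (by positivity)
    | exact m3.smul _ (by positivity)
    | exact m4.smul _ (by positivity)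
    | exact m5.smul _ (by positivity)
    | exact m6.smul _ (by positivity)
    | exact m7.smul _ (by positivity)
    | exact m8.smul _ (by positivity)
    | exact m9.smul _ (by positivity)
    | exact m10.smul _ (by positivity)
    | exact m11.smul _ (by positivity)
    | exact m12.smul _ (by positivity)
    | exact m13.smul _ (by positivity)

/-- The seed programme's target gives every W-aware triangle-dominated host: if `θ_△ (V a) (V b)` lies in the cone
for all pure inputs, the host is a cone host. -/
theorem coneHost_ex2_of_domW_pure (c s₁ s₂ s₃ : ℕ)
    (h0 : tcount Z₁ u u' a₁ (false, true, false, true, false, true) =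
      c + 0 + tcount Z₁ u u' a₁ (false, true, true, false, false, false)
        + tcount Z₁ u u' a₁ (false, false, false, true, true, false)
        + tcount Z₁ u u' a₁ (false, true, false, false, true, false))
    (h1 : tcount Z₁ u u' a₁ (false, true, false, true, true, true) = c + s₁)
    (h2 : tcount Z₁ u u' a₁ (true, false, true, true, true, false) = c + s₂)
    (h3 : tcount Z₁ u u' a₁ (true, true, true, false, true, false) = c + s₃)
    (h : ∀ {m m' : ℕ} (a : Fin m → ℝ) (b : Fin m' → ℝ), (∀ i, 0 ≤ a i ∧ a i ≤ 1) → (∀ j, 0 ≤ b j ∧ b j ≤ 1) →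
      InCone (thetaTri (V a) (V b))) : ConeHost Z₁ (ex2 u u') a₁ :=
  coneHost_ex2_of_domW Z₁ u u' a₁ c s₁ s₂ s₃ h0 h1 h2 h3 fun _ _ hX hY => InCone_thetaTri_of_pure h hX hY

end MultiExit

end ZoneZ

end PercRepro
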